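import Summits.BirchSwinnertonDyer.BirchSwinnertonDyer.Theorems.ClassRecordThreeCornerAtThreeShimuraFamilyProducersLocal
import Summits.BirchSwinnertonDyer.BirchSwinnertonDyer.Theorems.ClassRecordThreeEulerHalvesAtThreeShimuraFamilyKummerPlacesTamagawa
import Summits.BirchSwinnertonDyer.BirchSwinnertonDyer.Theorems.ClassRecordThreeCornerAtThreeShimuraWalkSplitCarrier
import Summits.BirchSwinnertonDyer.BirchSwinnertonDyer.Theorems.Rank1ResidualJetCarrierRowData
import Summits.BirchSwinnertonDyer.BirchSwinnertonDyer.Theorems.Rank1ResidualJetRingClassFields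
import HarnessLib

/-!
# SINGLE-DATUM local producers on a Shimura frame with the label (B6) asked ONLY AT THE CARRIER PRIMES outside `S`
# (`3 ∣ c_q(E/ℚ_q)`): Gross 6.2 (1) `hSel` from `LabelsAt` + per-carrier (B6) + Milne *ADT* I Prop. 3.8, and Jetchev 4.9 `hstrq`
# at the exempted carrier from its own singleton label — the (B6) PRECISION ROUTE, step F3
# (cell `bsd-stepL`, seat `bsd-stepL-tam3-p1` g15, LINE OWNER of crux 19109; `--supports stmt-BirchSwinnertonDyer-19109 --as helper`)

WHY (19109 `Lines/inert.lean` r10 → r11; corner3-p2 CORNER3-G9 §4(a); tam3-p1 g14 FINAL (i)). Lane B's single-datum producers p605614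
(`kolyvaginClass_familyData_mem_selmerLocalKer_of_labelsAt`, `localization_kolyvaginClass_familyData_mem_stringentFamily_of_labelsAt`)
read the `E⁰(K̄_v)`-receptacle off `LabelB6 ι W N (N.primeFactors.filter (· ∉ S)) ys` — the label (B6) at EVERY bad prime outside `S`.
With tam3-p1 g15's Tamagawa-keyed Kummer-places theorem (`kolyvaginClass_familyData_mem_selmerLocalKer_of_tamagawa`, p-F2: receptacle
only at the places with `p ∣ c_v(E/K_v)`, the others by Milne I.3.8) the label is needed only at the CARRIER primes: this file's
producers take `hB6T : ∀ q [Fact q.Prime], q ∣ N → q ∉ S → p ∣ c_q(E/ℚ_q) → LabelB6 ι W N {q} ys` (per-prime SINGLETON labels, the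
line's ℚ-side Tamagawa currency) and the displayed Milne hypothesis `hM38`. The passage `p ∣ c_v(E/K_v) ⟹ p ∣ c_q(E/ℚ_q)` at a place
`v` over a prime `q ∉ S` with two primes of `K` above it is bsd-jet's carrier row data `c_v = c_q` (`carrierRowData_of_split`, at a
place moved by complex conjugation; every `v ∋ q` is, `smul_ne_self_of_ncard_eq_two`).

RESULTS (namespace `Summit.BirchSwinnertonDyer.BirchSwinnertonDyer.Theorems.ShimuraWalk`):
* `smul_ne_self_of_ncard_eq_two` — for `K` imaginary quadratic, `τ ≠ 1`, a prime `q ∣ N` with `#((q).primesOver 𝓞_K) = 2`: every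
  place `v ∋ q` of `K` satisfies `τ • v ≠ v` (tam3-p1 g14's inline block of p606391, factored).
* `dvd_localTamagawaNumber_padic_of_dvd_of_ncard_eq_two` — at such a place, `p ∣ c_v(E/K_v) → p ∣ c_q(E/ℚ_q)`.
* `kolyvaginClass_familyData_mem_selmerLocalKer_of_labelsAt_of_tamagawa` — `hSel` VERBATIM (∀ M n d, 1 ≤ M → d.y = ys n → … →
  ∀ 𝔳 ∌ n, c_M(d) ∈ Sel_𝔳) from `LabelsAt`, `hB6T`, `hM38`, admissibility.
* `localization_kolyvaginClass_familyData_mem_stringentFamily_of_labelB6_singleton` — `hstrq` at every BAD place `v ∋ q` (`q ∣ N`,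
  `q ∉ S` split) from `LabelsAt` and the SINGLETON label `LabelB6 ι W N {q} ys` (p605614's text with `Q := {q}`).

HONEST FRAMING. Helper lemmas toward crux 19109 `EulerHalvesAtThree` (line `Lines/inert.lean` r10, stub `stub_primitivesWithB6AtThree`)
and 21420; CONDITIONAL on the displayed labels and `hM38` (cite-only Literature def `Milne2006_localTamagawaNumber_smul_unramifiedClass_eq_zero`,
p614601); nothing about BSD, `J₃`, or any divisibility of a Heegner point is asserted; no stub is discharged; no item closes; 0 classes
move (T7). `K : Type`. References: [cite: GrossLMS1991, §6 Prop. 6.2 (1)] [cite: Jetchev2008, Prop. 4.6, Cor. 4.8, Prop. 4.9]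
[cite: GrossZagier1986, III (3.1)] [cite: MilneADT2006, Ch. I Prop. 3.8] [cite: CasselsFrohlichANT1967, Ch. VII Prop. 1.2 (ii), Ch. II §10].
Axioms: `propext`, `Classical.choice`, `Quot.sound`.
-/

set_option autoImplicit false
set_option linter.dupNamespace false

noncomputable section

open scoped Classical NumberField Pointwise

namespace Summit.BirchSwinnertonDyer.BirchSwinnertonDyer.Theorems.ShimuraWalk

open WeierstrassCurve Field NumberField IsDedekindDomain Finset
  Literature.NumberTheory.EllipticCurves Literature.NumberTheory.GaloisRepresentations
  Literature.NumberTheory.EllipticCurves.KolyvaginCocycle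
  Literature.NumberTheory.EllipticCurves.RingClassField
  Literature.NumberTheory.EllipticCurves.ModularForms
  Summit.BirchSwinnertonDyer.Rank1Residual.X11b
  Summit.BirchSwinnertonDyer.Rank1Residual.JET
  Summit.BirchSwinnertonDyer.BirchSwinnertonDyer.Theorems
  Literature.NumberTheory.EllipticCurves.ShimuraCMFamily Literature.NumberTheory.Automorphic

variable {K : Type} [Field K] [NumberField K] {W : WeierstrassCurve ℚ} {ι : K →+* ℂ}

/-! ## §1 Places over a split prime are moved by complex conjugation; `c_v = c_q` -/

/-- For `K` imaginary quadratic, `τ ≠ 1` in `Aut(K/ℚ)` and a prime `q ∣ N` with exactly two primes of `K` above it, EVERY place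
`v ∋ q` of `K` is moved by `τ` (there is one such place, `exists_split_place_of_ncard_eq_two`; the places over `q` form one
`Aut(K/ℚ)`-orbit, `Aut(K/ℚ) = {1, τ}`, `τ² = 1`). tam3-p1 g14's inline block of p606391, factored.
[cite: CasselsFrohlichANT1967, Ch. VII Prop. 1.2 (ii)] -/
theorem smul_ne_self_of_ncard_eq_two {N : ℕ} (hK : IsImaginaryQuadratic K) (τ : K ≃ₐ[ℚ] K) (hτ : τ ≠ 1)
    (q : ℕ) [Fact q.Prime] (hq2 : ((Ideal.span {(q : ℤ)}).primesOver (𝓞 K)).ncard = 2) (hqN : q ∣ N)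
    (v : HeightOneSpectrum (𝓞 K)) (hqv : ((q : ℕ) : 𝓞 K) ∈ v.asIdeal) : τ • v ≠ v := by
  haveI : Algebra.IsQuadraticExtension ℚ K := ⟨hK.1⟩
  have hcard : Nat.card (K ≃ₐ[ℚ] K) = 2 := by rw [IsGalois.card_aut_eq_finrank, hK.1]
  obtain ⟨τ', hτ', huniq⟩ := (Nat.card_eq_two_iff' (1 : K ≃ₐ[ℚ] K)).mp hcard
  have hττ' : τ = τ' := huniq τ hτ
  subst hττ'
  have hτ2 : τ * τ = 1 := by
    rw [mul_eq_one_iff_eq_inv]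
    exact (huniq τ⁻¹ (inv_ne_one.mpr hτ)).symm
  obtain ⟨v₀, hv₀, -, hqv₀⟩ := exists_split_place_of_ncard_eq_two K hK τ hτ q hq2 hqN
  intro hτv
  obtain ⟨σ, hσ⟩ := HeightOneSpectrum.exists_algEquiv_smul_eq (F := ℚ) (w := v₀) (w' := v)
    (LocalField.heightOneSpectrum_rat_eq_of_natCast_mem q _ _
      (LocalField.natCast_mem_under q v₀ hqv₀) (LocalField.natCast_mem_under q v hqv))
  by_cases hσ1 : σ = 1
  · subst hσ1
    rw [one_smul] at hσ
    subst hσ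
    exact hv₀ hτv
  · have hστ : σ = τ := huniq σ hσ1
    subst hστ
    subst hσ
    rw [smul_smul, hτ2, one_smul] at hτv
    exact hv₀ hτv.symm

/-- **`p ∣ c_v(E/K_v) ⟹ p ∣ c_q(E/ℚ_q)`** at a place `v` of the imaginary quadratic `K` over a prime `q ∣ N` with two primes above it
(bsd-jet's carrier row data `c_v = c_q` at a place moved by complex conjugation, `carrierRowData_of_split`).
[cite: CasselsFrohlichANT1967, Ch. II §10] [cite: SilvermanAEC2009, VII.6 Ex. 7.6] -/
theorem dvd_localTamagawaNumber_padic_of_dvd_of_ncard_eq_two [W.IsElliptic] [W.IsGloballyMinimal] {N : ℕ}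
    (hK : IsImaginaryQuadratic K) (q : ℕ) [Fact q.Prime]
    (hq2 : ((Ideal.span {(q : ℤ)}).primesOver (𝓞 K)).ncard = 2) (hqN : q ∣ N)
    (v : HeightOneSpectrum (𝓞 K)) (hqv : ((q : ℕ) : 𝓞 K) ∈ v.asIdeal) {p : ℕ}
    (hcv : p ∣ ((W.baseChange K).baseChange (v.adicCompletion K)).localTamagawaNumber (v.adicCompletionIntegers K)) :
    p ∣ (W.baseChange ℚ_[q]).localTamagawaNumber ℤ_[q] := by
  haveI : Algebra.IsQuadraticExtension ℚ K := ⟨hK.1⟩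
  have hcard : Nat.card (K ≃ₐ[ℚ] K) = 2 := by rw [IsGalois.card_aut_eq_finrank, hK.1]
  obtain ⟨τ, hτ, -⟩ := (Nat.card_eq_two_iff' (1 : K ≃ₐ[ℚ] K)).mp hcard
  have hτv := smul_ne_self_of_ncard_eq_two hK τ hτ q hq2 hqN v hqv
  obtain ⟨-, -, hcEq, -, -⟩ := carrierRowData_of_split W K q hK τ v hτv hqv
  rwa [hcEq] at hcv

/-! ## §2 `hSel`: Gross 6.2 (1) for every datum, (B6) only at the carriers, Milne I.3.8 elsewhere -/

set_option maxHeartbeats 800000 in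
/-- **The producer `hSel`** (Gross 6.2 (1): `c_M(d) ∈ Sel_𝔳` at every finite `𝔳 ∤ n`) for EVERY datum `d` with `d.y = ys n` on a Shimura
frame `(W, N, K, S)` carrying `LabelsAt`, the label (B6) AT THE CARRIER PRIMES OUTSIDE `S` ONLY (`hB6T`, singleton labels under
`p ∣ c_q(E/ℚ_q)`), the displayed Milne I.3.8 hypothesis `hM38` (unramified classes of `H¹(K_v, E)` are killed by `c_v`), `E[p]`
irreducible, admissible `E(K[m])`: tam3-p1's binder shape verbatim. p-F2 on the extension of `d`; the receptacle at a carrier place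
`v ∋ q` is read off `hB6T q` through `familyReceptacle_of_labelB6` with `Q := {q}`, the premise `p ∣ c_q(E/ℚ_q)` being
`dvd_localTamagawaNumber_padic_of_dvd_of_ncard_eq_two` of the Kummer theorem's `p ∣ c_v(E/K_v)`.
[cite: GrossLMS1991, §6 Prop. 6.2 (1)] [cite: Jetchev2008, Prop. 4.6, Cor. 4.8] [cite: MilneADT2006, Ch. I Prop. 3.8] -/
theorem kolyvaginClass_familyData_mem_selmerLocalKer_of_labelsAt_of_tamagawa {N : ℕ} [NeZero N] [W.IsElliptic]
    [W.IsGloballyMinimal]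
    (hK : IsImaginaryQuadratic K) (ι : K →+* ℂ) (hN : W.conductorNorm ℤ = N) {p : ℕ} [Fact p.Prime]
    (Dt : ModularParametrizationData W N) [∀ j : ℕ, NumberField (ringClassField K ι j)] (hirr : W.HasIrreducibleModPGaloisRep p)
    {S : Finset ℕ}
    (hin : ∀ ℓ ∈ S, ℓ.Prime ∧ ℓ ∣ N ∧ ¬ ℓ ^ 2 ∣ N ∧
      ((Ideal.span {(ℓ : ℤ)}).primesOver (𝓞 K)).ncard = 1 ∧ ¬ (ℓ : ℤ) ∣ NumberField.discr K)
    (hsp : ∀ ℓ : ℕ, ℓ.Prime → ℓ ∣ N → ℓ ∉ S → ((Ideal.span {(ℓ : ℤ)}).primesOver (𝓞 K)).ncard = 2)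
    (ys : (m : ℕ) → (W.baseChange (ringClassField K ι m)).toAffine.Point)
    {yK : (W.baseChange K).toAffine.Point} {ε : ℤ} (hL : LabelsAt W N K ι yK ys ε)
    (hB6T : ∀ (q : ℕ) [Fact q.Prime], q ∣ N → q ∉ S → p ∣ (W.baseChange ℚ_[q]).localTamagawaNumber ℤ_[q] →
      LabelB6 ι W N {q} ys)
    (hM38 : ∀ (v : HeightOneSpectrum (𝓞 K)) {𝔐 : Ideal (v.localAbsIntegers)}, 𝔐 ∈ v.localPrimesAbove →
      ∀ f : contOneCocycles (discreteTopRep (absoluteGaloisGroup (v.adicCompletion K))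
          (localPoints (W.baseChange K) (v.adicCompletion K))),
        (∀ σ ∈ 𝔐.inertia (absoluteGaloisGroup (v.adicCompletion K)), f.1 σ = 0) →
        (((W.baseChange K).baseChange (v.adicCompletion K)).localTamagawaNumber (v.adicCompletionIntegers K) : ℤ) •
          oneCocycleClass (discreteTopRep (absoluteGaloisGroup (v.adicCompletion K))
            (localPoints (W.baseChange K) (v.adicCompletion K))) f = 0)
    (hA : ∀ (m : ℕ) (dm : KolyvaginFamilyData W K ι m), dm.y = ys m → Squarefree m →
      (∀ q ∈ m.primeFactors, IsKolyvaginPrime N W K p q) →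
      ∀ j : ℕ, IsAdmissible (absoluteGaloisGroup K) dm.pointsSubgroup ((p ^ j : ℕ) : ℤ))
    (M n : ℕ) (d : KolyvaginFamilyData W K ι n) (hM : 1 ≤ M) (hdy : d.y = ys n) (hn : Squarefree n)
    (hKol : ∀ q ∈ n.primeFactors, IsKolyvaginPrime N W K p q ∧ FrobEqFrobInfty W K (p ^ M) q)
    (𝔳 : HeightOneSpectrum (𝓞 K)) (h𝔳 : (n : 𝓞 K) ∉ 𝔳.asIdeal) :
    d.kolyvaginClass (Fact.out : p.Prime) M ∈ selmerLocalKer (W.baseChange K) (𝔳.adicCompletion K) ((p ^ M : ℕ) : ℤ) := by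
  have hp : p.Prime := Fact.out
  have hn0 : n ≠ 0 := hn.ne_zero
  have hguard : ∀ q ∈ n.primeFactors, ¬ q ∣ N ∧ (Ideal.span {(q : 𝓞 K)}).IsPrime :=
    fun q hq ↦ ⟨(hKol q hq).1.2.1, (hKol q hq).1.2.2.2.2.1⟩
  obtain ⟨D, hDd, hDy⟩ := exists_familyData_extension (W := W) hK ι hn (fun q hq ↦ (hguard q hq).2) ys d hdy
  subst hDd
  obtain ⟨hB4d, -, -⟩ := familyLabels_of_labelsAt (W := W) hn hguard ys hL D hDy
  have hcopT : IsCoprime (p : ℤ) (W.torsionOrder : ℤ) := ShimuraKolyvaginOfImage.isCoprime_torsionOrder_of_irr W p hirr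
  have hcop : IsCoprime ((p ^ M : ℕ) : ℤ) (W.torsionOrder : ℤ) := by
    rw [Nat.cast_pow]; exact hcopT.pow_left
  have hA' : ∀ (m : ℕ) (hm : m ∣ n), IsAdmissible (absoluteGaloisGroup K) (D m hm).pointsSubgroup ((p ^ M : ℕ) : ℤ) :=
    fun m hm ↦ hA m (D m hm) (hDy m hm) (hn.squarefree_of_dvd hm)
      (fun q hq ↦ (hKol q (Nat.primeFactors_mono hm hn0 hq)).1) M
  have hrec : ∀ (q : ℕ), q.Prime → q ∣ N → q ∉ S → ∀ (m : ℕ) (hm : m ∣ n)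
      (γ : ringClassField K ι m ≃ₐ[ℚ] ringClassField K ι m) (v : HeightOneSpectrum (𝓞 K)),
      ((q : ℕ) : 𝓞 K) ∈ v.asIdeal →
      p ∣ ((W.baseChange K).baseChange (v.adicCompletion K)).localTamagawaNumber (v.adicCompletionIntegers K) →
        (W.torsionOrder : ℤ) • pointsMap (W.baseChange K) (v.adicCompletion K)
            ((D m hm).toGeomPoints (pointGalHom W (ringClassField K ι m) γ (D m hm).y)) ∈
          E0Receptacle (W.baseChange K) v ∧
        ∀ (ℓ : ℕ) (hℓ : ℓ ∈ m.primeFactors)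
          (hle : ringClassField K ι (m / ℓ) ≤ ringClassField K ι m),
          (W.torsionOrder : ℤ) • pointsMap (W.baseChange K) (v.adicCompletion K)
              ((D m hm).toGeomPoints (pointGalHom W (ringClassField K ι m) γ
                (WeierstrassCurve.Affine.Point.map (W' := W)
                  ((RingClassField.inclusion ι hle).restrictScalars ℚ)
                  (D (m / ℓ) ((Nat.div_dvd_of_dvd (Nat.dvd_of_mem_primeFactors hℓ)).trans hm)).y))) ∈
            E0Receptacle (W.baseChange K) v := by
    intro q hqp hqN hqS m hm γ v hqv hcv
    haveI : Fact q.Prime := ⟨hqp⟩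
    have hq2 := hsp q hqp hqN hqS
    have hcq : p ∣ (W.baseChange ℚ_[q]).localTamagawaNumber ℤ_[q] :=
      dvd_localTamagawaNumber_padic_of_dvd_of_ncard_eq_two (W := W) hK q hq2 hqN v hqv hcv
    have hB6q : LabelB6 ι W N {q} ys := hB6T q hqN hqS hcq
    exact (familyReceptacle_of_labelB6 (W := W) hK ι p hirr hn hguard ys hB6q D hDy).2 q
      (Finset.mem_singleton_self q) hqp hqN hq2 m hm γ v hqv
  exact kolyvaginClass_familyData_mem_selmerLocalKer_of_tamagawa hK ι hN hp hM Dt hM38 hin hn hKol D hB4d hcop hrec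
    hA' n dvd_rfl 𝔳 h𝔳

/-! ## §3 `hstrq`: Jetchev 4.9 for every datum at the bad places over the exempted carrier `q`, from its SINGLETON label -/

set_option maxHeartbeats 800000 in
/-- **The producer `hstrq`** (Jetchev Prop. 4.9: `loc_v c_k(d) ∈ H¹_{𝓕⁰}(K_v)` at a bad place `v` over the exempted split prime
`q ∉ S`, `q ∣ N`) for EVERY datum `d` with `d.y = ys n` on a Shimura frame carrying `LabelsAt` and the SINGLETON label
`LabelB6 ι W N {q} ys` at that prime, `E[p]` irreducible, admissible `E(K[m])` — p605614's text with `Q := {q}`.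
[cite: Jetchev2008, Prop. 4.9, Cor. 4.8] [cite: GrossZagier1986, III (3.1)] -/
theorem localization_kolyvaginClass_familyData_mem_stringentFamily_of_labelB6_singleton {N : ℕ} [NeZero N] [W.IsElliptic]
    [W.IsGloballyMinimal]
    (hK : IsImaginaryQuadratic K) (ι : K →+* ℂ) {p : ℕ} [Fact p.Prime]
    (Dt : ModularParametrizationData W N) [∀ j : ℕ, NumberField (ringClassField K ι j)] (hirr : W.HasIrreducibleModPGaloisRep p)
    {S : Finset ℕ}
    (hsp : ∀ ℓ : ℕ, ℓ.Prime → ℓ ∣ N → ℓ ∉ S → ((Ideal.span {(ℓ : ℤ)}).primesOver (𝓞 K)).ncard = 2)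
    (ys : (m : ℕ) → (W.baseChange (ringClassField K ι m)).toAffine.Point)
    {yK : (W.baseChange K).toAffine.Point} {ε : ℤ} (hL : LabelsAt W N K ι yK ys ε)
    (q : ℕ) [Fact q.Prime] (hqN : q ∣ N) (hqS : q ∉ S) (hB6q : LabelB6 ι W N {q} ys)
    (hA : ∀ (m : ℕ) (dm : KolyvaginFamilyData W K ι m), dm.y = ys m → Squarefree m →
      (∀ q ∈ m.primeFactors, IsKolyvaginPrime N W K p q) →
      ∀ j : ℕ, IsAdmissible (absoluteGaloisGroup K) dm.pointsSubgroup ((p ^ j : ℕ) : ℤ))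
    (k : ℕ) (hn' : ((p ^ k : ℕ) : ℤ) ≠ 0) (n : ℕ) (d : KolyvaginFamilyData W K ι n) (hk : 1 ≤ k) (hdy : d.y = ys n)
    (hn : Squarefree n)
    (hKol : ∀ q' ∈ n.primeFactors, IsKolyvaginPrime N W K p q' ∧ FrobEqFrobInfty W K (p ^ k) q')
    (v : HeightOneSpectrum (𝓞 K)) (hqv : ((q : ℕ) : 𝓞 K) ∈ v.asIdeal) (hbad : ¬ (W.baseChange K).HasGoodReductionAt v) :
    galoisCohomology.localization ((W.baseChange K).torsionGaloisModule ((p ^ k : ℕ) : ℤ)) (Sum.inr v) 1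
        (d.kolyvaginClass (Fact.out : p.Prime) k) ∈ stringentFamily W K hn' (Sum.inr v) := by
  have hp : p.Prime := Fact.out
  have hq : q.Prime := Fact.out
  have hn0 : n ≠ 0 := hn.ne_zero
  have hguard : ∀ q' ∈ n.primeFactors, ¬ q' ∣ N ∧ (Ideal.span {(q' : 𝓞 K)}).IsPrime :=
    fun q' hq' ↦ ⟨(hKol q' hq').1.2.1, (hKol q' hq').1.2.2.2.2.1⟩
  -- `v ∌ n`: the primes of `n` are prime to `N`, `q ∣ N`
  have hnv : (n : 𝓞 K) ∉ v.asIdeal :=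
    natCast_not_mem_asIdeal_of_prime_mem v hq hqv hn0 fun ℓ hℓ hℓq ↦ (hguard ℓ hℓ).1 (hℓq ▸ hqN)
  obtain ⟨D, hDd, hDy⟩ := exists_familyData_extension (W := W) hK ι hn (fun q' hq' ↦ (hguard q' hq').2) ys d hdy
  subst hDd
  obtain ⟨hB4d, -, -⟩ := familyLabels_of_labelsAt (W := W) hn hguard ys hL D hDy
  obtain ⟨hcopT, hrecQ⟩ := familyReceptacle_of_labelB6 (W := W) hK ι p hirr hn hguard ys hB6q D hDy
  have hcop : IsCoprime ((p ^ k : ℕ) : ℤ) (W.torsionOrder : ℤ) := by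
    rw [Nat.cast_pow]; exact hcopT.pow_left
  have hA' : ∀ (m : ℕ) (hm : m ∣ n), IsAdmissible (absoluteGaloisGroup K) (D m hm).pointsSubgroup ((p ^ k : ℕ) : ℤ) :=
    fun m hm ↦ hA m (D m hm) (hDy m hm) (hn.squarefree_of_dvd hm)
      (fun q' hq' ↦ (hKol q' (Nat.primeFactors_mono hm hn0 hq')).1) k
  have hq2 := hsp q hq hqN hqS
  exact localization_kolyvaginClass_familyData_mem_stringentFamily hK ι hp hk hn' Dt hn hKol D hB4d hA' dvd_rfl q hqN hq2
    v hqv hnv hbad hcop (fun γ ↦ hrecQ q (Finset.mem_singleton_self q) hq hqN hq2 n dvd_rfl γ v hqv)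

end Summit.BirchSwinnertonDyer.BirchSwinnertonDyer.Theorems.ShimuraWalk

end
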